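import Summits.BirchSwinnertonDyer.BirchSwinnertonDyer.Theorems.Rank1ResidualIntModelReduction
import Summits.BirchSwinnertonDyer.Rank1Residual.X11b.CertificateRecordsGeneric
import Summits.BirchSwinnertonDyer.Rank1Residual.X11b.TamagawaQuadraticPlaces
import Summits.BirchSwinnertonDyer.Rank1Residual.X11b.ChaPairsMinimality
import Literature.NumberTheory.EllipticCurves.PointCountEulerCriterion
import Literature.NumberTheory.EllipticCurves.NeronModelProofs
import Literature.NumberTheory.EllipticCurves.NeronComponentIndexSplitProofs
import Literature.NumberTheory.EllipticCurves.RootNumberTwistProofs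
import Literature.NumberTheory.EllipticCurves.LFunctionPrimeCoeff
import Literature.NumberTheory.EllipticCurves.OrdinaryPrimesProofs
import Literature.NumberTheory.EllipticCurves.BSDConductorProofs
import Literature.NumberTheory.DiophantineGeometry.TateAlgorithmAdditiveProofs
import HarnessLib

/-!
# Typed congruent-curve Selmer transfer — ROW-INDEPENDENT RECORD GLUE (sha-2 GEN 26, staged)

HONEST FRAMING (cell `b2b-bsdres`, verbatim): prove what is provable now; shrink each hard class to
its core with data; no claim beyond stated classes. EVIDENCE-grade, staged by the sha-2 instrument seat
for ADOPT-AND-FILE by a filing seat; nothing is booked; no named fact; no label moves.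

The kernel-side binders of the typed consumer `X11b/CongruentSelmerTransferTyped.lean`
(`bsdp_of_congruent_{singleton,pair,transverse,agree}_typed`) that a per-row record must discharge from
the two integer models are: the instances `IsElliptic` / `IsGloballyMinimal` of BOTH curves
(Kraus–Oesterlé 1992 Prop. 4, "modèles minimaux"), `hirr` (tree theorem
`IntModel.hasIrreducibleModPGaloisRep_of_intModel_of_noroot`, Mazur 1978 Prop. 6.3 (1)), `hT` (both
curves good and `v ∤ p` off a finite set of places) and the TYPED branch of `hcheck` (`v ∤ p` and
`p ∤ #Φ_v(k̄)` for both curves: the printed hypothesis of Gross–Parson 2012 Lemma 6). This file is the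
row-independent glue: `placesOf M` (the places over the prime factors of `M`) with `mem_placesOf_iff`,
`placeOf q`, **`good_off_placesOf`** (`hT` from `|Δ_min| ∣ M^k` for both curves and `p ∣ M`),
**`not_dvd_componentGroupOrder_of_hasAdditiveReductionAt`** (additive place, `p ≥ 5`),
**`componentGroupOrder_eq_padicValInt_of_intModel`** (multiplicative place: `#Φ = v_q(Δ(E₀))`), and the
x11c-style literal-model tests `isElliptic_of_discOf_ne_zero` (tree, `X11b/ChaPairsMinimality.lean`) /
`isGloballyMinimal_of_minSupportCheckT`;
good-place glue `not_dvd_componentGroupOrder_of_hasGoodReductionAt`, `natCast_mem_asIdeal_placeOf`,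
`natCast_not_mem_asIdeal_placeOf`, `placeOf_ne_placeOf`, and the H5 glue
**`localTamagawaNumber_eq_of_split_of_intModel`** (`c_v = v_q(Δ(E₀))` at a split multiplicative place; records generator, ADDENDUM-4).
Demonstrated on the row `430d1 @ 5` in `CongruentSelmerTransferTypedRecord430d1.lean`.

References: J. H. Silverman, AEC (2009) VII.1, VII.5.1, VII.6.1, VIII.8 [SilvermanAEC2009]; A. Kraus,
Acta Arith. 54 (1989) [Kraus1989]; B. Mazur, Invent. Math. 44 (1978) Prop. 6.3 (1) [Mazur1978];
A. Kraus, J. Oesterlé (1992) Prop. 4 [KrausOesterle1992]; B. Gross, J. Parson (2012) Lemma 6 [GrossParson2011].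
-/

set_option autoImplicit false

noncomputable section

open scoped Classical

open IsDedekindDomain NumberField Rat.HeightOneSpectrum WeierstrassCurve
  Literature.NumberTheory.EllipticCurves Literature.NumberTheory.DiophantineGeometry
  Literature.NumberTheory.EllipticCurves.Rank1Residual
  Literature.NumberTheory.EllipticCurves.Rank1Residual.X11RankOneCertificates
  Summit.BirchSwinnertonDyer.BirchSwinnertonDyer.Rank1Residual

namespace Summit.BirchSwinnertonDyer.Rank1Residual.X11b.CongruentTransfer.Records

/-! ## §0 Row-independent glue -/

/-- The finite places of `ℚ` over the prime factors of `M`. [folklore] -/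
def placesOf (M : ℕ) : Finset (HeightOneSpectrum (𝓞 ℚ)) :=
  Finset.univ.image fun q : M.primeFactors =>
    (primesEquiv (R := 𝓞 ℚ)).symm ⟨q, Nat.prime_of_mem_primeFactors q.2⟩

/-- `v ∈ placesOf M ↔ ℓ_v ∣ M` (as a prime factor). [folklore] -/
theorem mem_placesOf_iff {M : ℕ} {v : HeightOneSpectrum (𝓞 ℚ)} :
    v ∈ placesOf M ↔ ((primesEquiv v : Nat.Primes) : ℕ) ∈ M.primeFactors := by
  constructor
  · intro hv
    obtain ⟨q, -, rfl⟩ := Finset.mem_image.mp hv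
    rw [Equiv.apply_symm_apply]; exact q.2
  · intro h
    refine Finset.mem_image.mpr ⟨⟨_, h⟩, Finset.mem_univ _, ?_⟩
    change (primesEquiv (R := 𝓞 ℚ)).symm ⟨((primesEquiv v : Nat.Primes) : ℕ), _⟩ = v
    rw [Subtype.coe_eta, Equiv.symm_apply_apply]

/-- The place over a literal prime `q`. [folklore] -/
def placeOf (q : ℕ) [hq : Fact q.Prime] : HeightOneSpectrum (𝓞 ℚ) :=
  (primesEquiv (R := 𝓞 ℚ)).symm ⟨q, hq.out⟩

/-- `ℓ_{placeOf q} = q`. [folklore] -/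
@[simp] theorem primesEquiv_placeOf (q : ℕ) [Fact q.Prime] :
    ((primesEquiv (placeOf q) : Nat.Primes) : ℕ) = q := by
  rw [placeOf, Equiv.apply_symm_apply]

/-- `v = placeOf ℓ_v`. [folklore] -/
theorem eq_placeOf_of_primesEquiv_eq {v : HeightOneSpectrum (𝓞 ℚ)} {q : ℕ} [hq : Fact q.Prime]
    (hv : ((primesEquiv v : Nat.Primes) : ℕ) = q) : v = placeOf q := by
  rw [placeOf, Equiv.eq_symm_apply]; exact Subtype.ext hv

/-- **`hT` glue**: off the places over the prime factors of `M` — with `p ∣ M` and both global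
minimal discriminants dividing a power of `M` — both curves have good reduction and `v ∤ p`.
[cite: SilvermanAEC2009, VII.5.1(a) and VIII.8] -/
theorem good_off_placesOf (W Y : WeierstrassCurve ℚ) [W.IsElliptic] [W.IsGloballyMinimal]
    [Y.IsElliptic] [Y.IsGloballyMinimal] {p M k : ℕ} (hp : p.Prime) (hpM : p ∣ M) (hM : M ≠ 0)
    (hW : W.minimalDiscriminantInt.natAbs ∣ M ^ k) (hY : Y.minimalDiscriminantInt.natAbs ∣ M ^ k) :
    ∀ v ∉ placesOf M,
      ((p : ℕ) : 𝓞 ℚ) ∉ v.asIdeal ∧ W.HasGoodReductionAt v ∧ Y.HasGoodReductionAt v := by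
  intro v hv
  haveI := Fact.mk (primesEquiv v).2
  have hq : ¬ ((primesEquiv v : Nat.Primes) : ℕ) ∣ M := fun h =>
    hv (mem_placesOf_iff.mpr (Nat.mem_primeFactors.mpr ⟨(primesEquiv v).2, h, hM⟩))
  have hqk : ¬ ((primesEquiv v : Nat.Primes) : ℕ) ∣ M ^ k := fun h =>
    hq ((primesEquiv v).2.dvd_of_dvd_pow h)
  have hgood : ∀ (X : WeierstrassCurve ℚ) [X.IsElliptic] [X.IsGloballyMinimal],
      X.minimalDiscriminantInt.natAbs ∣ M ^ k → X.HasGoodReductionAt v := by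
    intro X _ _ hX
    have hnd : ¬ (((primesEquiv v : Nat.Primes) : ℕ) : ℤ) ∣ X.minimalDiscriminantInt := fun h =>
      hqk ((Int.natCast_dvd.mp h).trans hX)
    exact (hasGoodReductionAtPrime_iff_hasGoodReductionAt_ringOfIntegers (W := X) (v := v)).mp
      (hasGoodReductionAtPrime_of_not_dvd X _ hnd)
  refine ⟨fun hmem => hq ?_, hgood W hW, hgood Y hY⟩
  rw [(natCast_mem_asIdeal_iff_eq_primesEquiv_symm v hp).mp hmem, Equiv.apply_symm_apply]
  exact hpM

/-- An additive Kodaira symbol has component group of order `≤ 4`, so prime to every `p ≥ 5`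
(Tate's algorithm table). [cite: SilvermanAEC2009, VII.6.1 and Table 15.1 (p. 448)] -/
theorem not_dvd_componentGroupOrder_of_isAdditive {k : KodairaSymbol} (hk : k.IsAdditive) {p : ℕ}
    (hp : 5 ≤ p) : ¬ p ∣ k.componentGroupOrder := by
  have hle : k.componentGroupOrder ≤ 4 := by
    cases k <;> simp_all [KodairaSymbol.componentGroupOrder, KodairaSymbol.IsAdditive,
      KodairaSymbol.IsGood, KodairaSymbol.IsMultiplicative]
  intro h
  have := Nat.le_of_dvd (KodairaSymbol.componentGroupOrder_pos (k := k)) h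
  omega

/-- **`hcheck` glue at an additive place** `v ∤ p`, `p ≥ 5`: `p ∤ #Φ_v`.
[cite: SilvermanAEC2009, VII.6.1 and Table 15.1 (p. 448)] -/
theorem not_dvd_componentGroupOrder_of_hasAdditiveReductionAt (W : WeierstrassCurve ℚ)
    [W.IsElliptic] {v : HeightOneSpectrum (𝓞 ℚ)} (h : W.HasAdditiveReductionAt v) {p : ℕ}
    (hp : 5 ≤ p) : ¬ p ∣ (W.kodairaSymbolAt v).componentGroupOrder :=
  not_dvd_componentGroupOrder_of_isAdditive
    ((WeierstrassCurve.isAdditive_kodairaSymbolAt_iff_holds v W).mpr h) hp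

/-- **`hcheck` glue at a multiplicative place**: for the globally minimal `W` with integral model
`E₀` and a prime `q ∣ Δ(E₀)`, `q ∤ c₄(E₀)`, the component group at the place over `q` has order
`#Φ_q(k̄) = v_q(Δ(E₀))` (Kodaira `I_n`, `n = v_q(Δ_min)`). [cite: SilvermanAEC2009, VII.5.1(b) and VII.6.1] -/
theorem componentGroupOrder_eq_padicValInt_of_intModel (W : WeierstrassCurve ℚ) [W.IsElliptic]
    [W.IsGloballyMinimal] {E₀ : WeierstrassCurve ℤ} (hI : integralModelInt W = E₀) {q : ℕ}
    [hq : Fact q.Prime] {v : HeightOneSpectrum (𝓞 ℚ)} (hv : ((primesEquiv v : Nat.Primes) : ℕ) = q)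
    (hΔ : (q : ℤ) ∣ E₀.Δ) (hc₄ : ¬ (q : ℤ) ∣ E₀.c₄) :
    (W.kodairaSymbolAt v).componentGroupOrder = padicValInt q E₀.Δ := by
  have hP : W.HasMultiplicativeReductionAtPrime q :=
    IntModel.hasMultiplicativeReductionAtPrime_of_intModel hI q hΔ hc₄
  subst hv
  have hmul : W.HasMultiplicativeReductionAt v :=
    (hasMultiplicativeReductionAtPrime_iff_hasMultiplicativeReductionAt_ringOfIntegers
      (W := W) (v := v)).mp hP
  rw [kodairaSymbolAt_eq_I_ordMinimalDiscriminant (W := W) (v := v) hmul,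
    X11b.ordMinimalDiscriminant_eq_padicValInt W v rfl, IntModel.minimalDiscriminantInt_eq hI]
  have h0 : E₀.Δ ≠ 0 := by
    rw [← IntModel.minimalDiscriminantInt_eq hI]; exact minimalDiscriminantInt_ne_zero W
  have h1 : 1 ≤ padicValInt (primesEquiv v : ℕ) E₀.Δ :=
    one_le_padicValNat_of_dvd (Int.natAbs_ne_zero.mpr h0) (Int.natCast_dvd.mp hΔ)
  simp only [KodairaSymbol.componentGroupOrder]
  exact max_eq_left h1

/-- **`hcheck` glue at a good place** `v`: `#Φ_v = 1` (Kodaira `I₀`), so `p ∤ #Φ_v` for `p ≥ 2`.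
[cite: SilvermanAEC2009, VII.6.1 and Table 15.1 (p. 448)] -/
theorem not_dvd_componentGroupOrder_of_hasGoodReductionAt (W : WeierstrassCurve ℚ) [W.IsElliptic]
    {v : HeightOneSpectrum (𝓞 ℚ)} (h : W.HasGoodReductionAt v) {p : ℕ} (hp : 2 ≤ p) :
    ¬ p ∣ (W.kodairaSymbolAt v).componentGroupOrder := by
  have hI : W.kodairaSymbolAt v = .I 0 := (WeierstrassCurve.isGood_kodairaSymbolAt_iff_holds v W).mpr h
  have h1 : (KodairaSymbol.I 0).componentGroupOrder = 1 := by decide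
  rw [hI, h1, Nat.dvd_one]
  omega

/-- **H5 glue at the removed split multiplicative place**: for the globally minimal `W` with integer
model `E₀`, split multiplicative at the place `v` over `q`, the local Tamagawa number is
`c_v = v_q(Δ(E₀))` (Kodaira `I_n`, all `n` components rational), read off `qᵉ ‖ Δ(E₀)`.
[cite: SilvermanATAEC1994, Cor. IV.9.2(d) and Table 4.1] [cite: SilvermanAEC2009, VIII.8] -/
theorem localTamagawaNumber_eq_of_split_of_intModel (W : WeierstrassCurve ℚ) [W.IsElliptic]
    [W.IsGloballyMinimal] {E₀ : WeierstrassCurve ℤ} (hI : integralModelInt W = E₀) {q : ℕ}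
    [Fact q.Prime] {v : HeightOneSpectrum (𝓞 ℚ)} (hv : ((primesEquiv v : Nat.Primes) : ℕ) = q)
    (hs : W.HasSplitMultiplicativeReductionAt v) {e : ℕ} (he : (q : ℤ) ^ e ∣ E₀.Δ)
    (he' : ¬ (q : ℤ) ^ (e + 1) ∣ E₀.Δ) :
    (W.baseChange (v.adicCompletion ℚ)).localTamagawaNumber (v.adicCompletionIntegers ℚ) = e := by
  rw [Literature.NumberTheory.EllipticCurves.localTamagawaNumber_eq_ordMinimalDiscriminant_of_hasSplitMultiplicativeReductionAt
      v W hs, X11b.ordMinimalDiscriminant_eq_padicValInt W v hv, IntModel.minimalDiscriminantInt_eq hI,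
    IntModel.padicValInt_eq_of_dvd_of_not_dvd q he he']

/-- `q ∈ 𝔭_{placeOf q}`. [folklore] -/
theorem natCast_mem_asIdeal_placeOf (q : ℕ) [hq : Fact q.Prime] :
    ((q : ℕ) : 𝓞 ℚ) ∈ (placeOf q).asIdeal :=
  (natCast_mem_asIdeal_iff_eq_primesEquiv_symm (placeOf q) hq.out).mpr rfl

/-- `p ∉ 𝔭_{placeOf q}` for primes `p ≠ q`. [folklore] -/
theorem natCast_not_mem_asIdeal_placeOf {p : ℕ} (hp : p.Prime) (q : ℕ) [hq : Fact q.Prime]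
    (h : p ≠ q) : ((p : ℕ) : 𝓞 ℚ) ∉ (placeOf q).asIdeal := fun hmem => by
  have h' := congrArg (fun v => ((primesEquiv v : Nat.Primes) : ℕ))
    ((natCast_mem_asIdeal_iff_eq_primesEquiv_symm (placeOf q) hp).mp hmem)
  simp only [primesEquiv_placeOf, Equiv.apply_symm_apply] at h'
  exact h h'.symm

/-- `placeOf a ≠ placeOf b` for distinct primes. [folklore] -/
theorem placeOf_ne_placeOf {a b : ℕ} [Fact a.Prime] [Fact b.Prime] (h : a ≠ b) :
    placeOf a ≠ placeOf b := fun hab => by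
  have := congrArg (fun v => ((primesEquiv v : Nat.Primes) : ℕ)) hab
  simp only [primesEquiv_placeOf] at this
  exact h this

/-- x11c's support-based minimality test: listed primes prime, `|Δ| = ∏ q^{v_q Δ}`, and per prime
Silverman `q¹² ∤ Δ ∨ q⁴ ∤ c₄` / Kraus at `2` / `3⁸ ‖ c₆` at `3`. [folklore] -/
def minSupportCheckT (a : List ℤ) (bad : List (ℕ × ℕ × ℕ)) : Bool :=
  bad.all (fun t => isPrimeBelow504100 t.1) &&
  (((bad.map fun t => t.1 ^ t.2.2).prod : ℕ) == (discOf a).natAbs) &&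
  bad.all (X11b.minCheckAt a)

/-- Global minimality from a passing `minSupportCheckT` (soundness = x11c's
`X11b.isGloballyMinimal_of_krausCriterion_support`).
[cite: SilvermanAEC2009, VII.1 Remark 1.1 and VIII.8] [cite: Kraus1989, Prop. 1 and Prop. 2] -/
theorem isGloballyMinimal_of_minSupportCheckT (a1 a2 a3 a4 a6 : ℤ)
    (bad : List (ℕ × ℕ × ℕ)) (h : minSupportCheckT [a1, a2, a3, a4, a6] bad = true) :
    (⟨a1, a2, a3, a4, a6⟩ : WeierstrassCurve ℚ).IsGloballyMinimal := by
  simp only [minSupportCheckT, Bool.and_eq_true, List.all_eq_true, beq_iff_eq] at h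
  obtain ⟨⟨hpr, hprod⟩, hmin⟩ := h
  refine X11b.isGloballyMinimal_of_krausCriterion_support a1 a2 a3 a4 a6 bad
    (fun t ht ↦ prime_of_isPrimeBelow504100 (hpr t ht)) hprod.symm fun t ht ↦ ?_
  have hmt := hmin t ht
  simp only [X11b.minCheckAt, Bool.or_eq_true, Bool.and_eq_true, decide_eq_true_eq, beq_iff_eq]
    at hmt
  rcases hmt with ((h12 | h4) | ⟨⟨⟨h2, h16⟩, h64⟩, hk⟩) | ⟨⟨h3, h8⟩, h9⟩
  · exact Or.inl (Or.inl h12)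
  · exact Or.inl (Or.inr h4)
  · exact Or.inr (Or.inl ⟨h2, h16, h64, hk⟩)
  · exact Or.inr (Or.inr ⟨h3, h8, h9⟩)


end Summit.BirchSwinnertonDyer.Rank1Residual.X11b.CongruentTransfer.Records
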